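import Literature.MathematicalPhysics.QuantumFieldTheory.Balaban1983to89.B9Eq358KnitTransporterVariationY
import Literature.MathematicalPhysics.QuantumFieldTheory.Balaban1983to89.B9Cor36GpCubeEntriesAtV
import Literature.MathematicalPhysics.QuantumFieldTheory.Balaban1983to89.Node00.OpsYCubeKnitPar

/-!
# `Balaban1983to89.B9Eq359CubeKernelsKnitAtOne` — [Balaban1985BackgroundPropagators] (3.58)–(3.59) p. 402 FOR THE CUBE's KERNEL LETTERS `kF`, `sF`
# (r05 FILE 1's `kFCubeY`, `sFCubeY`) AT def-Y's CUBE-LEVEL KNIT TRANSPORTER `parKnitCubeY i □` (road P4, (β)), BASE `U = 1` (Cor. 3.5's case):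
# `‖U′(Γ^{(n)}_{y,w}) − 1‖ ≤ 154(d+1)·α₁` for `U′ = e^{iηa}·1` under the cube sequence's own-level (3.37), hence `‖kF(s,w)‖ ≤ C_q^K·α₁·W(s)⁻¹`,
# `‖sF(z)‖ ≤ C_q^K·α₁` (`C_q^K = 770(d+1)`) in the `hkF`∕`hsF` shapes of `B9Thm34SectBUniformR1.thm34_Gp_uniform` — p06's key estimate at the FLAT base through
# n06-l's bridge; the twin of r05's `B9Eq359CubeKernelsAtOne` (taxicab `parSymY`) — sub-row G-B9-LETTERS (site sector), seat dag-n06-c g32 UNIT 4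

statement-level skeleton of published theorems with citation tags; proofs where landed; nothing here is a claim about the Yang–Mills mass gap

CITATION HEADER (lean-in-tree rule).  B9 = T. Bałaban, *Propagators for lattice gauge theories in a background field*, Commun. Math. Phys. **99** (1985)
389–434 [Balaban1985BackgroundPropagators] (held `paper:balaban1985-cmp99-background-propagators`; journal page = PDF page + 388): (3.55)–(3.58) pp. 401–402
«(U′U)(Γ^{(j)}_{y,x}) = \overline{(U′U)}^{j−1}(Γ_{y,x_{j−1}})·…·(U′U)(Γ_{x₁,x}) … by the above bounds |(U′U)(Γ^{(j)}_{y,x})(U(Γ^{(j)}_{y,x}))⁻¹ − 1| < O(1)α₁»,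
«|F′_{2,j}(A; y, x)| ≦ O(1)α₁ (3.58)», «a similar expansion for the adjoint operator»; (3.37) p. 396 «|A′| < α₁(Lʲη)⁻¹ … on Ω_j»; Cor. 3.5 p. 407 «with U = 1»;
p. 409 l. 3–5 (the cube letters obey the same inequalities); (3.19) p. 393; (3.24) p. 394.  [5] = [Balaban1985Averaging] Prop. 2 p. 26, Prop. 6 (164) p. 43.
Rows B9.(3.58)–(3.59) (cells only; no row head changes).

WHY THIS FILE (road P4 of the N06 h36b campaign: print's Dirichlet cube letter with def-Y's cube-level knit legs `parKnitCubeY` — dag-n06-d g32 (T-□), this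
seat's word (β), def-Y g39 ✓`Node00/OpsYCubeKnitPar`).  UNIT 2's `cor35_GpDir_cube` leaves, among the `A`-dependent binders of the engine, the (3.59) kernel sizes
`hkF : ‖kF y x‖ ≤ C_q·α₁·w(y)`, `hsF : ‖sF x‖ ≤ C_q·α₁` for r05 FILE 1's letters `kFCubeY i □ par 1 Ṽ`, `sFCubeY i □ par 1 Ṽ` at the transporter of record.
r05's `B9Eq359CubeKernelsAtOne` gives them at the taxicab `parSymY`; at `parKnitCubeY` the transporter from the corner of the cube block `s = (n, y)` to `w` is
print's composite `U(Γ^{(n)}_{y,w})` (def-Y's `knitTL` at `lv := lev_□`; `parKnitCubeY_blkCornerCubeY`), and at the flat base `U = 1` the (3.57) factor is the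
composite of `e^{iηa}·1` itself, so p06's key estimate `B9Eq358KeyEstimate.norm_pFac_sub_one_le_linear` applies DIRECTLY (`pdev 1 = 0`, unitary base), through
n06-l's bridge `B9Eq358KnitTransporterVariationY.compT_bgT_eq_compT358` and locality `compT_bgT_congr` (the exponent restricted to the block box has size
`α₁L^{−n}` by the cube-blockwise (3.37) — §1).  §3 turns `‖U′(Γ) − 1‖ ≤ ε` into the operator sizes of `kF = W⁻¹(R(U′(Γ)) − 1)` and `sF = R(U′(Γ)⁻¹) − 1`
(`B9Cor36GpCubeEntriesAtV.norm_R_sub_self_le_of_small`, `ε ≤ 1/4` from p06's window).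

WHAT IS PROVED (1 `def` with body — the constant `CqK d = 770(d+1)`; 0 sorry; 0 new named facts; standard axioms):
* §1 `mem_XB_of_blk_eq_cube` (a cube block is full — J-B's `mem_XB_of_blk_eq` for `𝔅_□`), `blkOf_toBox_transl_eq`, ★`norm_blockExponentCube_le` (the block exponent
  is `α₁L^{−n}`-small from the cube's own-level (3.37), `ownLevel_of_blockwise` shape), ★`parKnitCubeY_blkCornerCubeY` (the cube letter at a corner pair IS
  `compT L (bgT L V♯) n y w`); LOCALITY of def-Y's letter: `agreeOn_liftCfg_of_blkCube`, ★`knitCubeY_congr_of_agree_block` (the cube knit leg reads `U` on the bonds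
  INSIDE the cube block only — n06-d's `knitT_liftCfg_congr` for `𝔅_□` with the inside-only hypothesis), `blkCubeY_eq_of_avgCoeffCubeY_ne_zero`,
  ★`avgTrCubeY_parKnitCubeY_congr_of_agree_block`;
* §2 ★★★`norm_parKnitCubeY_mulY_one_sub_one_le` — **(3.58) AT `parKnitCubeY`, BASE `1`, CORNER PAIRS**: `‖U′(Γ^{(n)}_{y,w}) − 1‖ ≤ 154(d+1)·α₁` (`𝔸 = M_N(ℂ)`, p06's
  window `e^{4·800(d+2)²(d+5)α₀′}(1 + 8·131072(d+2)²α₁) ≤ 2`, `2α₁ ≤ c₃`, `4096(d+1)α₁ ≤ 1`, `0 < α₀′`, `C₀α₀′ ≤ 1/3`, `4α₀′ ≤ c₂′` — n06-l's shapes);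
* §3 `norm_inv_sub_one_le`, `CqK`, `CqK_nonneg`, ★★★`norm_kFCubeY_parKnitCubeY_one_le` (`hkF`), ★★★`norm_sFCubeY_parKnitCubeY_one_le` (`hsF`).

PROOF.  Ours (bookkeeping over p06's landed estimate and n06-l's landed bridge).  Crude constant `770(d+1)` for print's `O(1)`.

HONEST SCOPE / NOT CLAIMED.  `𝔸 = M_N(ℂ)` (p06's averaging machinery); BASE `U = 1` only (the cube road's case — the raw field re-enters by gauge covariance, UNIT 3
§4); CORNER PAIRS (the pairs the letters read); p06's numerics displayed; nothing on `d = 4`, the continuum, reflection positivity or the mass gap; NOT a node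
discharge; no row head changes.

RELATED IN THE TREE, NOT DUPLICATED: r05's `B9Eq359CubeKernelsAtOne` (same sizes at `parSymY`, other transporter), n06-l's `B9Eq358KnitTransporterVariationY`
(member knit letter `parKnitY`, general (3.35) base with retraction — its bridge and `‖c′ − c‖` lemma are IMPORTED), n06-d's `B9KnitTransporterLocalityY` (member-level
locality at `parKnitY`, all bonds at the block's sites), def-Y's `Node00/OpsYCubeKnitPar` (the letter, used by name), p06's `B9Eq358KeyEstimate` (the analysis, used by name).
-/

noncomputable section

namespace Literature.MathematicalPhysics.QuantumFieldTheory.Balaban1983to89.B9Eq359CubeKernelsKnitAtOne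

open scoped BigOperators
open NormedSpace
open B7Prop1Explicit renaming Site → LSite
open B7Prop1Explicit (U1 axialFn)
open B7Prop1Local (InBox AgreeOn)
open Literature.MathematicalPhysics.QuantumLattice (blockBase blockMap)
open B7Prop5Flat (bondsIn mem_bondsIn restr agreeOn_insCfg_restr agreeOn_expCfg)
open B7Prop3Flat (insCfg expCfg c3)
open B7Prop2Explicit (pdev avgIter avgIter_mem AvgClosed avgClosed_unitaryUnits unitaryUnits unitaryUnits_le_U1 C0 c2')
open B8Eq119TwistedAxial (bgT bgT_one)
open B8Ineq130 (fl)
open B10Eq27TorusAxialLog (transl transl_add_e)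
open B4Reflection242 (blk boxDom mem_boxDom)
open B6Geom246MultiLevelBoxL0 (bset blkOf blkOf_eq_iff_blk lev_eq_of_blkOf_eq exists_blkOf_eq scale_bounds corner_mem coord_bounds)
open B6GlobalChartV1 (PV boxEquiv boxEquiv_apply toBox)
open B6KLevelCensusIndexV1 (KIdx kGeo)
open B6Prop22KLevelTorusCensus (KTIdx)
open B6MultiLevelBoxOperator (N0)
open B6Cover236MultiLevelBlocks (cubes)
open B6Ineq268MultiLevelBoxL0 (W W_pos)
open B9B8CarrierDictionary (liftCfg liftCfg_mem liftCfg_apply)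
open B9B8AveragingJunction (blockMap_iterate blk_eq_blockMap boxEquiv_transl_of_mem coord_bounds_of_blk_eq)
open B9Eq3124HZKnitPairReg335Y (compT_bgT_congr blk_eq_of_inBox_block)
open B9Eq358Decomposition (pFac compT_mem)
open B9Eq358KeyEstimate (norm_pFac_sub_one_le_linear)
open B9Eq358KnitTransporterVariationY (compT_bgT_eq_compT358 norm_units_sub_le_of_pFac)
open B9Eq380QknitVariationY (liftCfg_mulY_fluct)
open B9Eq39Adjoint (R R_one fluct)
open B9Eq360DeltaPrimeAY (Rclm Rclm_apply mulY AfldY chartA chartA_apply)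
open B9Eq360DeltaPrimeACubeY (blkCubeY kQCubeY sQCubeY kFCubeY sFCubeY cornerY_levCubeY_eq)
open B9CubeLettersOpsL0 (cubeFamY levCubeY)
open B9CubeLettersBondOpsL0 (BlkCubeY blkCornerCubeY)
open B9Cor36GpCubeEntriesAtV (norm_R_sub_self_le_of_small)
open Node00
open Node00.OpsYCubeKnitPar (knitTL parOfTL parKnitLY parKnitCubeY parKnitCubeY_apply parOfTL_corner_left parKnitCubeY_one parKnitCubeY_inv)

variable {d ℓ : ℕ} {hd : 1 ≤ d + 1} {hL : Odd (ℓ + 1) ∧ 1 < ℓ + 1} {b₀ b₁ : ℝ}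

/-! ## §1  A cube block is full: box points of the block lift to sites of the block; the cube-level exponent on the block box -/

section Block

variable {𝔸 : Type} [NormedRing 𝔸] [NormedAlgebra ℂ 𝔸] [CompleteSpace 𝔸]
variable (i : KIdx d ℓ hd hL b₀ b₁) (c : ↥(cubes (toKT i).D.toDomains))

omit [NormedRing 𝔸] [NormedAlgebra ℂ 𝔸] [CompleteSpace 𝔸] in
/-- **A BLOCK OF `𝔅_□` IS FULL**: every point of `ℤ^{d+1}` whose `L^{n_s}`-label is the label of the cube block `s` lies in the member's fundamental box (J-B's
`mem_XB_of_blk_eq` for the cube family: `L^{n_s}` divides the side, `n_s ≤ k`, the block meets the box). [cite: Balaban1984PropagatorsII, (2.1) p.224; Balaban1985BackgroundPropagators, p.408, dictionary] -/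
theorem mem_XB_of_blk_eq_cube (s : BlkCubeY i c) {x : Fin (d + 1) → ℤ} (hx : blk ((ℓ + 1) ^ s.1.1) x = s.1.2) : x ∈ (toKT i).XB := by
  obtain ⟨z₀, hz₀⟩ := exists_blkOf_eq (cubeFamY i c).toDomains s
  have hjk : s.1.1 ≤ i.k := (scale_bounds (cubeFamY i c).toDomains s).2
  have hb1 : 1 ≤ (ℓ + 1) ^ s.1.1 := Nat.one_le_pow _ _ (Nat.succ_pos ℓ)
  have hbz : (0 : ℤ) < (((ℓ + 1) ^ s.1.1 : ℕ) : ℤ) := by positivity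
  have hcor := mem_boxDom.1 (corner_mem (cubeFamY i c).toDomains s)
  have hz₀box := mem_boxDom.1 z₀.2
  rw [KTIdx.XB, mem_boxDom]
  intro μ
  obtain ⟨hlo, hhi⟩ := coord_bounds_of_blk_eq hb1 hx μ
  have hc0 : 0 ≤ (((ℓ + 1) ^ s.1.1 : ℕ) : ℤ) * s.1.2 μ := (hcor μ).1
  refine ⟨le_trans hc0 hlo, ?_⟩
  obtain ⟨q, hq⟩ : ∃ q : ℕ, N0 ℓ i.Mh i.k i.P' μ = (ℓ + 1) ^ s.1.1 * q :=
    ⟨(ℓ + 1) ^ (i.k - s.1.1) * ((ℓ + 1) * (i.Mh * i.P' μ)), by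
      rw [← mul_assoc, ← pow_add, Nat.add_sub_cancel' hjk]⟩
  have hN : ((N0 ℓ i.Mh i.k i.P' μ : ℕ) : ℤ) = (((ℓ + 1) ^ s.1.1 : ℕ) : ℤ) * q := by rw [hq]; push_cast; ring
  have hz₀lt : z₀.1 μ < (((ℓ + 1) ^ s.1.1 : ℕ) : ℤ) * q := hN ▸ (hz₀box μ).2
  have hz₀lo := (coord_bounds (cubeFamY i c).toDomains hz₀ μ).1
  have hyq : s.1.2 μ < q := by
    by_contra hcon
    push Not at hcon
    have : (((ℓ + 1) ^ s.1.1 : ℕ) : ℤ) * q ≤ (((ℓ + 1) ^ s.1.1 : ℕ) : ℤ) * s.1.2 μ := mul_le_mul_of_nonneg_left hcon hbz.le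
    linarith
  show x μ < ((N0 ℓ i.Mh i.k i.P' μ : ℕ) : ℤ)
  rw [hN]
  have : (((ℓ + 1) ^ s.1.1 : ℕ) : ℤ) * (s.1.2 μ + 1) ≤ (((ℓ + 1) ^ s.1.1 : ℕ) : ℤ) * q :=
    mul_le_mul_of_nonneg_left (by linarith) hbz.le
  linarith

omit [NormedRing 𝔸] [NormedAlgebra ℂ 𝔸] [CompleteSpace 𝔸] in
/-- every box point `x` of the cube block `s = (n, y) ∈ 𝔅_□` lifts the torus site `0 + x`, which lies in the block `s` (so its cube level is EXACTLY `n`).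
[cite: Balaban1984PropagatorsII, (2.3)–(2.4) p.224; Balaban1985BackgroundPropagators, (3.37) p.396, p.408] -/
theorem blkOf_toBox_transl_eq (s : BlkCubeY i c) {x : LSite (d + 1)}
    (hx : InBox (blockBase ((ℓ + 1) ^ s.1.1) s.1.2) (blockBase ((ℓ + 1) ^ s.1.1) s.1.2 + ((((ℓ + 1 : ℕ) : ℤ) ^ s.1.1) - 1) • (1 : LSite (d + 1))) x) :
    blkOf (cubeFamY i c).toDomains (toBox i.hN (transl (0 : Site (PV d ℓ i.m i.K hd hL) 0) x)) = s := by
  have hblk : blk ((ℓ + 1) ^ s.1.1) x = s.1.2 := blk_eq_of_inBox_block hx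
  have hxXB : x ∈ (toKT i).XB := mem_XB_of_blk_eq_cube i c s hblk
  have hbox : toBox i.hN (transl (0 : Site (PV d ℓ i.m i.K hd hL) 0) x) = ⟨x, hxXB⟩ := by
    rw [← boxEquiv_apply]; exact boxEquiv_transl_of_mem i hxXB
  refine (blkOf_eq_iff_blk (cubeFamY i c).toDomains).2 ?_
  have hv : (toBox i.hN (transl (0 : Site (PV d ℓ i.m i.K hd hL) 0) x)).1 = x := congrArg Subtype.val hbox
  exact (congrArg (blk ((ℓ + 1) ^ s.1.1)) hv).trans hblk

omit [CompleteSpace 𝔸] in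
/-- ★ **THE CUBE-BLOCK EXPONENT IS `α₁L^{−n}`-SMALL**: under the cube sequence's own-level (3.37) on the block `s = (n, y)` — `η‖a_ν(v)‖ ≤ α₁L^{−n}` for every site `v`
of `s` (Theorem 3.4's blockwise `‖A_k(x)‖ ≤ α₁(L^{n(x)}η)⁻¹` read on the chart, r05's `ownLevel_of_blockwise`) — the restriction `a♭` of the lifted exponent
`a♯(x, κ) = iη·a_κ(0 + x)` to the bonds of the block box satisfies `‖a♭(x, κ)‖ ≤ α₁·(Lⁿ)⁻¹` everywhere (outside: `0`).
[cite: Balaban1985BackgroundPropagators, (3.37) p.396, p.401 («|A| < α₁(Lʲη)⁻¹ on Bʲ(Λ_j)» p.406), p.409 l.3–5] -/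
theorem norm_blockExponentCube_le (s : BlkCubeY i c) {η α₁ : ℝ} (hη : 0 ≤ η) (hα₁ : 0 ≤ α₁) {a : AfldY 𝔸 i}
    (ha : ∀ (ν : Fin (d + 1)) (v : Site (PV d ℓ i.m i.K hd hL) 0), blkOf (cubeFamY i c).toDomains (toBox i.hN v) = s →
      η * ‖a ν v‖ ≤ α₁ * ((((ℓ + 1) ^ s.1.1 : ℕ) : ℝ))⁻¹) :
    ∀ (x : LSite (d + 1)) (κ : Fin (d + 1)),
      ‖insCfg (bondsIn (blockBase ((ℓ + 1) ^ s.1.1) s.1.2) (blockBase ((ℓ + 1) ^ s.1.1) s.1.2 + ((((ℓ + 1 : ℕ) : ℤ) ^ s.1.1) - 1) • (1 : LSite (d + 1))))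
          (restr (bondsIn (blockBase ((ℓ + 1) ^ s.1.1) s.1.2) (blockBase ((ℓ + 1) ^ s.1.1) s.1.2 + ((((ℓ + 1 : ℕ) : ℤ) ^ s.1.1) - 1) • (1 : LSite (d + 1))))
            (fun z μ => ((Complex.I * (η : ℝ) : ℂ)) • a μ (transl (0 : Site (PV d ℓ i.m i.K hd hL) 0) z))) x κ‖ ≤
        α₁ * ((((ℓ + 1 : ℕ) : ℝ)) ^ s.1.1)⁻¹ := by
  classical
  intro x κ
  set S := bondsIn (blockBase ((ℓ + 1) ^ s.1.1) s.1.2) (blockBase ((ℓ + 1) ^ s.1.1) s.1.2 + ((((ℓ + 1 : ℕ) : ℤ) ^ s.1.1) - 1) • (1 : LSite (d + 1))) with hS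
  have hLj : (0 : ℝ) < (((ℓ + 1 : ℕ) : ℝ)) ^ s.1.1 := by positivity
  by_cases hmem : (x, κ) ∈ S
  · have hval : insCfg S (restr S (fun z μ => ((Complex.I * (η : ℝ) : ℂ)) • a μ (transl (0 : Site (PV d ℓ i.m i.K hd hL) 0) z))) x κ =
        ((Complex.I * (η : ℝ) : ℂ)) • a κ (transl (0 : Site (PV d ℓ i.m i.K hd hL) 0) x) := by
      simp [insCfg, restr, hmem]
    rw [hval, norm_smul, norm_mul, Complex.norm_I, one_mul, Complex.norm_real, Real.norm_of_nonneg hη]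
    have h := ha κ (transl (0 : Site (PV d ℓ i.m i.K hd hL) 0) x) (blkOf_toBox_transl_eq i c s (mem_bondsIn.1 hmem).1)
    have e : ((((ℓ + 1) ^ s.1.1 : ℕ) : ℝ)) = (((ℓ + 1 : ℕ) : ℝ)) ^ s.1.1 := by push_cast; ring
    rw [e] at h
    exact h
  · have hval : insCfg S (restr S (fun z μ => ((Complex.I * (η : ℝ) : ℂ)) • a μ (transl (0 : Site (PV d ℓ i.m i.K hd hL) 0) z))) x κ = 0 := by
      simp [insCfg, hmem]
    rw [hval, norm_zero]; positivity

/-- ★ **THE CUBE LETTER AT A CORNER PAIR IS THE COMPOSITE TRANSPORTER**: for `w` in the cube block `s = (n, y)`,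
`parKnitCubeY V (c_s) w = V(Γ^{(n)}_{y,w}) = compT L (bgT L V♯) n y w` (def-Y's `parOfTL_corner_left` at `lv := lev_□`).
[cite: Balaban1985BackgroundPropagators, (3.19) p.393, p.409 l.1–5; Balaban1985Averaging, (52)–(53) p.27] -/
theorem parKnitCubeY_blkCornerCubeY (V : CfgY 𝔸 i) {s : BlkCubeY i c} {w : SiteY i} (hw : blkOf (cubeFamY i c).toDomains w = s) :
    parKnitCubeY i c V (blkCornerCubeY i c s) w = B9B8AveragingKernelZd.compT (ℓ + 1) (bgT (ℓ + 1) (liftCfg V)) s.1.1 s.1.2 w.1 := by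
  have hc : cornerY i (levCubeY i c w) w = blkCornerCubeY i c s := by rw [cornerY_levCubeY_eq i c w]; exact congrArg _ hw
  rw [parKnitCubeY_apply, ← hc, parOfTL_corner_left, knitTL]
  have hlev : levCubeY i c w = s.1.1 := lev_eq_of_blkOf_eq (cubeFamY i c).toDomains hw
  have hblk : blk ((ℓ + 1) ^ s.1.1) w.1 = s.1.2 := (blkOf_eq_iff_blk (cubeFamY i c).toDomains).1 hw
  rw [hlev, hblk]

/-- two backgrounds agreeing at the bonds INSIDE the cube block `s` (both endpoints in `s`) have periodic lifts agreeing, in [5]'s sense `AgreeOn`, on the block box —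
n06-d's `agreeOn_liftCfg_of_blk` for `𝔅_□` with the sharper inside-only hypothesis (the chart takes `x + e_κ` to `shiftY κ`: `transl_add_e`, `toBox_shift`).
[cite: Balaban1985Averaging, p.24 (locality sentence after (43)); Balaban1984PropagatorsII, (2.1) p.224, dictionary] -/
theorem agreeOn_liftCfg_of_blkCube {U U' : CfgY 𝔸 i} (s : BlkCubeY i c)
    (h : ∀ (v : SiteY i) (μ : Fin (d + 1)), blkOf (cubeFamY i c).toDomains v = s → blkOf (cubeFamY i c).toDomains (shiftY i μ v) = s →
      UboxY i U μ v = UboxY i U' μ v) :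
    AgreeOn (blockBase ((ℓ + 1) ^ s.1.1) s.1.2) (blockBase ((ℓ + 1) ^ s.1.1) s.1.2 + ((((ℓ + 1 : ℕ) : ℤ) ^ s.1.1) - 1) • (1 : LSite (d + 1)))
      (liftCfg U) (liftCfg U') := by
  intro x μ hx hxe
  have hv : blkOf (cubeFamY i c).toDomains (toBox i.hN (transl (0 : Site (PV d ℓ i.m i.K hd hL) 0) x)) = s := blkOf_toBox_transl_eq i c s hx
  have hv' : blkOf (cubeFamY i c).toDomains (shiftY i μ (toBox i.hN (transl (0 : Site (PV d ℓ i.m i.K hd hL) 0) x))) = s := by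
    have e : shiftY i μ (toBox i.hN (transl (0 : Site (PV d ℓ i.m i.K hd hL) 0) x)) =
        toBox i.hN (transl (0 : Site (PV d ℓ i.m i.K hd hL) 0) (x + B7Prop1Explicit.e μ)) := by
      rw [transl_add_e, B6ScalarChartV1.toBox_shift]; rfl
    rw [e]; exact blkOf_toBox_transl_eq i c s hxe
  have hh := h _ μ hv hv'
  have e : ∀ V : CfgY 𝔸 i, UboxY i V μ (toBox i.hN (transl (0 : Site (PV d ℓ i.m i.K hd hL) 0) x)) = liftCfg V x μ := fun V => by
    rw [liftCfg_apply]
    show V μ ((boxEquiv i.hN).symm (boxEquiv i.hN (transl (0 : Site (PV d ℓ i.m i.K hd hL) 0) x))) = V μ (transl 0 x)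
    rw [Equiv.symm_apply_apply]
  rw [← e U, ← e U']; exact hh

/-- ★ **THE CUBE KNIT LEG `U(Γ^{(lev_□ w)}_{y,w})` READS `U` ON THE BONDS INSIDE THE CUBE BLOCK OF `w` ONLY** (def-Y's `knitCubeY`; n06-l's `compT_bgT_congr` through the chart).
[cite: Balaban1985Averaging, p.24 (locality sentence after (43)), (52)–(53) p.27; Balaban1985BackgroundPropagators, (3.19) p.393, p.409] -/
theorem knitCubeY_congr_of_agree_block {U U' : CfgY 𝔸 i} (w : SiteY i)
    (h : ∀ (v : SiteY i) (μ : Fin (d + 1)), blkOf (cubeFamY i c).toDomains v = blkOf (cubeFamY i c).toDomains w →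
      blkOf (cubeFamY i c).toDomains (shiftY i μ v) = blkOf (cubeFamY i c).toDomains w → UboxY i U μ v = UboxY i U' μ v) :
    Node00.OpsYCubeKnitPar.knitCubeY i c U w = Node00.OpsYCubeKnitPar.knitCubeY i c U' w := by
  have hL1 : 1 ≤ ℓ + 1 := Nat.succ_pos ℓ
  set s : BlkCubeY i c := blkOf (cubeFamY i c).toDomains w with hs
  have hit : (blockMap (ℓ + 1))^[s.1.1] w.1 = s.1.2 := by
    rw [blockMap_iterate, ← blk_eq_blockMap]; exact (blkOf_eq_iff_blk (cubeFamY i c).toDomains).1 rfl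
  show B9B8AveragingKernelZd.compT (ℓ + 1) (bgT (ℓ + 1) (liftCfg U)) (levCubeY i c w) (blk ((ℓ + 1) ^ levCubeY i c w) w.1) w.1 =
    B9B8AveragingKernelZd.compT (ℓ + 1) (bgT (ℓ + 1) (liftCfg U')) (levCubeY i c w) (blk ((ℓ + 1) ^ levCubeY i c w) w.1) w.1
  have hlev : levCubeY i c w = s.1.1 := rfl
  have hblk : blk ((ℓ + 1) ^ s.1.1) w.1 = s.1.2 := (blkOf_eq_iff_blk (cubeFamY i c).toDomains).1 rfl
  rw [hlev, hblk, ← hit]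
  exact compT_bgT_congr hL1 s.1.1 w.1 (by rw [hit]; exact agreeOn_liftCfg_of_blkCube i c s h)

omit [NormedRing 𝔸] [NormedAlgebra ℂ 𝔸] [CompleteSpace 𝔸] in
/-- on the support of the cube coefficient the two sites lie in ONE cube block. [cite: Balaban1985BackgroundPropagators, (3.19) p.393, bookkeeping] -/
theorem blkCubeY_eq_of_avgCoeffCubeY_ne_zero {z w : SiteY i} (h : B9CubeLettersOpsL0.avgCoeffCubeY i c z w ≠ 0) :
    blkOf (cubeFamY i c).toDomains w = blkOf (cubeFamY i c).toDomains z := by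
  rw [B9Thm311CubeLettersFirstThree.avgCoeffCubeY_eq_ite] at h
  by_contra hne; exact h (if_neg hne)

/-- ★ **THE CUBE AVERAGING TRANSPORTER AT `parKnitCubeY` READS `U` ON THE BONDS INSIDE THE CUBE BLOCK** of the pair (on the support of the coefficient both sites and both
legs live in one block). [cite: Balaban1985BackgroundPropagators, (3.19) p.393, (3.24) p.394, p.409 l.1–5] -/
theorem avgTrCubeY_parKnitCubeY_congr_of_agree_block {U U' : CfgY 𝔸 i} {z w : SiteY i} (hzw : B9CubeLettersOpsL0.avgCoeffCubeY i c z w ≠ 0)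
    (h : ∀ (v : SiteY i) (μ : Fin (d + 1)), blkOf (cubeFamY i c).toDomains v = blkOf (cubeFamY i c).toDomains z →
      blkOf (cubeFamY i c).toDomains (shiftY i μ v) = blkOf (cubeFamY i c).toDomains z → UboxY i U μ v = UboxY i U' μ v) :
    B9CubeLettersOpsL0.avgTrCubeY i c (parKnitCubeY i c) U z w = B9CubeLettersOpsL0.avgTrCubeY i c (parKnitCubeY i c) U' z w := by
  have hb := blkCubeY_eq_of_avgCoeffCubeY_ne_zero i c hzw
  rw [Node00.OpsYCubeKnitPar.avgTrCubeY_parKnitCubeY i c U hzw, Node00.OpsYCubeKnitPar.avgTrCubeY_parKnitCubeY i c U' hzw,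
    knitCubeY_congr_of_agree_block i c z h, knitCubeY_congr_of_agree_block i c w (fun v μ hv hv' => h v μ (hv.trans hb) (hv'.trans hb))]

end Block

/-! ## §2  (3.58) at the cube letter `parKnitCubeY`, base `U = 1` (Cor. 3.5's case): `‖U′(Γ^{(n)}_{y,w}) − 1‖ ≤ 154(d+1)·α₁` -/

section Main

open scoped Matrix Matrix.Norms.L2Operator

variable {N : ℕ} [Nonempty (Fin N)] (i : KIdx d ℓ hd hL b₀ b₁) (c : ↥(cubes (toKT i).D.toDomains))

/-- ★★ **(3.58) AT THE CUBE LETTER, BASE `U = 1`, CORNER PAIRS**: for an exponent `a` with the cube sequence's own-level (3.37) on the block `s = (n, y)` of `w`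
(`η‖a_ν(v)‖ ≤ α₁L^{−n}` on `s`) and `α₁` in p06's window, `‖U′(Γ^{(n)}_{y,w}) − 1‖ ≤ 154(d+1)·α₁` for `U′ = e^{iηa}·1` — p06's key estimate
`norm_pFac_sub_one_le_linear` at the FLAT base (`pdev 1 = 0`, no retraction), through n06-l's bridge `compT_bgT_eq_compT358`, locality `compT_bgT_congr` putting the
exponent on the block box (§1).  The base `1` is the case the cube road uses (Cor. 3.5: «with U = 1»; the raw field re-enters by gauge covariance, Cor. 3.6).
[cite: Balaban1985BackgroundPropagators, (3.55)–(3.58) pp.401–402, Cor. 3.5 p.407, (3.37) p.396, p.409 l.3–5; Balaban1985Averaging, Prop. 6 (164) p.43] -/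
theorem norm_parKnitCubeY_mulY_one_sub_one_le
    {α₀' : ℝ} (hα' : 0 < α₀') (hα3 : C0 (d + 1) * α₀' ≤ 1 / 3) (hα4 : 4 * α₀' ≤ c2' (d + 1) (ℓ + 1))
    {η α₁ : ℝ} (hη : 0 ≤ η) (hα₁ : 0 ≤ α₁)
    (hsmall : Real.exp (4 * (800 * (((d + 1 : ℕ) : ℝ) + 1) ^ 2 * (((d + 1 : ℕ) : ℝ) + 4)) * α₀')
      * (1 + 8 * (131072 * (((d + 1 : ℕ) : ℝ) + 1) ^ 2) * α₁) ≤ 2)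
    (hc₃ : 2 * α₁ ≤ c3 (d + 1) (ℓ + 1)) (hsm : 4096 * ((d + 1 : ℕ) : ℝ) * α₁ ≤ 1)
    (a : AfldY (Matrix (Fin N) (Fin N) ℂ) i) (s : BlkCubeY i c)
    (ha : ∀ (ν : Fin (d + 1)) (v : Site (PV d ℓ i.m i.K hd hL) 0), blkOf (cubeFamY i c).toDomains (toBox i.hN v) = s →
      η * ‖a ν v‖ ≤ α₁ * ((((ℓ + 1) ^ s.1.1 : ℕ) : ℝ))⁻¹)
    {w : SiteY i} (hw : blkOf (cubeFamY i c).toDomains w = s) :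
    ‖((parKnitCubeY i c (mulY i (fluct η a) (fun _ _ => 1)) (blkCornerCubeY i c s) w : (Matrix (Fin N) (Fin N) ℂ)ˣ) : Matrix (Fin N) (Fin N) ℂ) - 1‖ ≤
      154 * ((d : ℝ) + 1) * α₁ := by
  letI : CStarAlgebra (Matrix (Fin N) (Fin N) ℂ) := {}
  have hL2 : 2 ≤ ℓ + 1 := hL.2
  have hL1 : 1 ≤ ℓ + 1 := Nat.succ_pos ℓ
  set Lj : ℝ := (((ℓ + 1 : ℕ) : ℝ)) ^ s.1.1 with hLj
  have hLj0 : 0 < Lj := by positivity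
  set lo : LSite (d + 1) := blockBase ((ℓ + 1) ^ s.1.1) s.1.2 with hlo
  set hi : LSite (d + 1) := blockBase ((ℓ + 1) ^ s.1.1) s.1.2 + ((((ℓ + 1 : ℕ) : ℤ) ^ s.1.1) - 1) • (1 : LSite (d + 1)) with hhi
  set Ash : LSite (d + 1) → Fin (d + 1) → Matrix (Fin N) (Fin N) ℂ :=
    fun z μ => ((Complex.I * (η : ℝ) : ℂ)) • a μ (transl (0 : Site (PV d ℓ i.m i.K hd hL) 0) z) with hAsh
  set Afl := insCfg (bondsIn lo hi) (restr (bondsIn lo hi) Ash) with hAfl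
  -- the label of `w`
  have hit : (blockMap (ℓ + 1))^[s.1.1] w.1 = s.1.2 := by
    rw [blockMap_iterate, ← blk_eq_blockMap]; exact (blkOf_eq_iff_blk (cubeFamY i c).toDomains).1 hw
  -- locality: the lift of `e^{iηa}·1` is `e^{a♯}·1`, and on the block box it agrees with `e^{a♭}·1`
  have hag1 : AgreeOn lo hi (liftCfg (P := PV d ℓ i.m i.K hd hL) (mulY i (fluct η a) (fun _ _ => 1)))
      (expCfg Afl * (1 : LSite (d + 1) → Fin (d + 1) → (Matrix (Fin N) (Fin N) ℂ)ˣ)) := by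
    have e : liftCfg (P := PV d ℓ i.m i.K hd hL) (mulY i (fluct η a) (fun _ _ => 1)) =
        expCfg Ash * liftCfg (P := PV d ℓ i.m i.K hd hL) (fun _ _ => (1 : (Matrix (Fin N) (Fin N) ℂ)ˣ)) := liftCfg_mulY_fluct i η a _
    rw [e]
    intro x κ hx hxe
    rw [Pi.mul_apply, Pi.mul_apply, Pi.mul_apply, Pi.mul_apply, agreeOn_expCfg (agreeOn_insCfg_restr _ _ Ash) x κ hx hxe]
    rfl
  have e1 : parKnitCubeY i c (mulY i (fluct η a) (fun _ _ => 1)) (blkCornerCubeY i c s) w =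
      B9B8AveragingKernelZd.compT (ℓ + 1) (bgT (ℓ + 1) (expCfg Afl * 1)) s.1.1 s.1.2 w.1 := by
    rw [parKnitCubeY_blkCornerCubeY i c _ hw, ← hit]
    exact compT_bgT_congr hL1 s.1.1 w.1 (by rw [hit]; exact hag1)
  rw [e1]
  -- through the bridge to p06's composite at the flat base
  have eb := compT_bgT_eq_compT358 (ℓ + 1) (expCfg Afl * (1 : LSite (d + 1) → Fin (d + 1) → (Matrix (Fin N) (Fin N) ℂ)ˣ)) s.1.1 w.1
  rw [hit] at eb
  rw [eb]
  -- the exponent has size `b := α₁L^{−n}`, `Lⁿb = α₁`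
  have hb0 : 0 ≤ α₁ * Lj⁻¹ := by positivity
  have hAfl : ∀ x κ, ‖Afl x κ‖ ≤ α₁ * Lj⁻¹ := norm_blockExponentCube_le i c s hη hα₁ ha
  have eLb : Lj * (α₁ * Lj⁻¹) = α₁ := by rw [mul_comm α₁, ← mul_assoc, mul_inv_cancel₀ hLj0.ne', one_mul]
  have hsmall' : Real.exp (4 * (800 * (((d + 1 : ℕ) : ℝ) + 1) ^ 2 * (((d + 1 : ℕ) : ℝ) + 4)) * α₀')
      * (1 + 8 * (131072 * (((d + 1 : ℕ) : ℝ) + 1) ^ 2) * (Lj * (α₁ * Lj⁻¹))) ≤ 2 := by rw [eLb]; exact hsmall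
  have hc₃' : 2 * (Lj * (α₁ * Lj⁻¹)) ≤ c3 (d + 1) (ℓ + 1) := by rw [eLb]; exact hc₃
  have hsm' : 4096 * ((d + 1 : ℕ) : ℝ) * (Lj * (α₁ * Lj⁻¹)) ≤ 1 := by rw [eLb]; exact hsm
  -- the flat base is (52)-regular for every `α₀′ > 0` and unitary-valued
  have h1u : ∀ x μ, (1 : LSite (d + 1) → Fin (d + 1) → (Matrix (Fin N) (Fin N) ℂ)ˣ) x μ ∈ unitaryUnits (Matrix (Fin N) (Fin N) ℂ) :=
    fun _ _ => Subgroup.one_mem _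
  have h52 : pdev (1 : LSite (d + 1) → Fin (d + 1) → (Matrix (Fin N) (Fin N) ℂ)ˣ) < α₀' * ((((ℓ + 1 : ℕ) : ℝ) ^ s.1.1)⁻¹) ^ 2 := by
    have hpdev : pdev (1 : LSite (d + 1) → Fin (d + 1) → (Matrix (Fin N) (Fin N) ℂ)ˣ) = 0 := by unfold pdev; simp [B8Ineq130.hol_one]
    rw [hpdev]; positivity
  have hP := norm_pFac_sub_one_le_linear (L := ℓ + 1) (G := unitaryUnits (Matrix (Fin N) (Fin N) ℂ)) (j := s.1.1)
    (U := (1 : LSite (d + 1) → Fin (d + 1) → (Matrix (Fin N) (Fin N) ℂ)ˣ)) (B := Afl) hL2 (avgClosed_unitaryUnits (d + 1) (ℓ + 1)) h1u hα' hα3 hα4 h52 hb0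
    hAfl hsmall' hc₃' hsm' s.1.2 (x := w.1) hit
  -- `P = compT (e^{a♭}·1) · compT(1)⁻¹ = compT (e^{a♭}·1)` (the flat composite is `1`: bridge + `bgT_one`)
  have e0 : B9Eq358Decomposition.compT (ℓ + 1) (1 : LSite (d + 1) → Fin (d + 1) → (Matrix (Fin N) (Fin N) ℂ)ˣ) s.1.1 s.1.2 w.1 = 1 := by
    have h := compT_bgT_eq_compT358 (ℓ + 1) (1 : LSite (d + 1) → Fin (d + 1) → (Matrix (Fin N) (Fin N) ℂ)ˣ) s.1.1 w.1
    rw [hit] at h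
    rw [← h, bgT_one, B9B8AveragingKernelZd.compT_one_legs]
  rw [pFac, e0, inv_one, mul_one, eLb] at hP
  refine hP.trans (le_of_eq ?_)
  push_cast; ring

/-! ## §3  (3.58)∕(3.59) for the kernel letters `kF`, `sF` of r05's FILE 1 at `parKnitCubeY`, base `U = 1`, in the `hkF`∕`hsF` shapes of `thm34_Gp_uniform` -/

omit [Nonempty (Fin N)] in
/-- a unit near `1` has its inverse near `1`: `‖u − 1‖ ≤ ε ≤ 1∕2 ⟹ ‖u⁻¹ − 1‖ ≤ 2ε` (`u⁻¹ − 1 = u⁻¹(1 − u)`, `‖u⁻¹‖ ≤ 1 + ‖u⁻¹ − 1‖`).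
[cite: Balaban1985BackgroundPropagators, p.401 («|(U′U)(Γ)(U(Γ))⁻¹ − 1| < O(1)α₁»), bookkeeping] -/
theorem norm_inv_sub_one_le {𝔸 : Type} [NormedRing 𝔸] [NormOneClass 𝔸] (u : 𝔸ˣ) {ε : ℝ} (hε : ε ≤ 1 / 2) (h : ‖(u : 𝔸) - 1‖ ≤ ε) :
    ‖((u⁻¹ : 𝔸ˣ) : 𝔸) - 1‖ ≤ 2 * ε := by
  have hε0 : 0 ≤ ε := (norm_nonneg _).trans h
  have e : ((u⁻¹ : 𝔸ˣ) : 𝔸) - 1 = ((u⁻¹ : 𝔸ˣ) : 𝔸) * (1 - (u : 𝔸)) := by rw [mul_sub, mul_one, Units.inv_mul]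
  have ht : ‖((u⁻¹ : 𝔸ˣ) : 𝔸) - 1‖ ≤ (‖((u⁻¹ : 𝔸ˣ) : 𝔸) - 1‖ + 1) * ε := by
    calc ‖((u⁻¹ : 𝔸ˣ) : 𝔸) - 1‖ = ‖((u⁻¹ : 𝔸ˣ) : 𝔸) * (1 - (u : 𝔸))‖ := by rw [e]
      _ ≤ ‖((u⁻¹ : 𝔸ˣ) : 𝔸)‖ * ‖1 - (u : 𝔸)‖ := norm_mul_le _ _
      _ ≤ (‖((u⁻¹ : 𝔸ˣ) : 𝔸) - 1‖ + 1) * ε := by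
          refine mul_le_mul ?_ (by rw [← norm_neg, neg_sub]; exact h) (norm_nonneg _) (by positivity)
          calc ‖((u⁻¹ : 𝔸ˣ) : 𝔸)‖ = ‖(((u⁻¹ : 𝔸ˣ) : 𝔸) - 1) + 1‖ := by rw [sub_add_cancel]
            _ ≤ ‖((u⁻¹ : 𝔸ˣ) : 𝔸) - 1‖ + ‖(1 : 𝔸)‖ := norm_add_le _ _
            _ = ‖((u⁻¹ : 𝔸ˣ) : 𝔸) - 1‖ + 1 := by rw [norm_one]
  nlinarith [norm_nonneg (((u⁻¹ : 𝔸ˣ) : 𝔸) - 1)]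

/-- **the (3.58) size `C_q^K = 770(d+1)`** at the cube knit letter (`5 × 154(d+1)`: the `R(·)`-conjugation costs `5ε`, `B9Cor36GpCubeEntriesAtV.norm_R_sub_self_le_of_small`).
[cite: Balaban1985BackgroundPropagators, (3.58) p.402] -/
def CqK (d : ℕ) : ℝ := 770 * ((d : ℝ) + 1)

omit [Nonempty (Fin N)] in
/-- `0 ≤ C_q^K`. [cite: Balaban1985BackgroundPropagators, (3.58) p.402, bookkeeping] -/
theorem CqK_nonneg (d : ℕ) : 0 ≤ CqK d := by unfold CqK; positivity

/-- ★★★ **(3.58) FOR THE CUBE's KERNEL LETTER AT `parKnitCubeY`, BASE `U = 1`, R1's `hkF` SHAPE**: under the cube sequence's own-level (3.37) on the block `s`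
and `α₁` in p06's window, `‖kF(s, w)‖ ≤ C_q^K·α₁·W(s)⁻¹` for `w ∈ Δ(s)` (`kF = kQ(e^{iηa}·1) − kQ(1)`, r05 FILE 1's `kFCubeY`).
[cite: Balaban1985BackgroundPropagators, (3.58) p.402, (3.19) p.393, (3.37) p.396, Cor. 3.5 p.407, p.409 l.3–5] -/
theorem norm_kFCubeY_parKnitCubeY_one_le
    {α₀' : ℝ} (hα' : 0 < α₀') (hα3 : C0 (d + 1) * α₀' ≤ 1 / 3) (hα4 : 4 * α₀' ≤ c2' (d + 1) (ℓ + 1))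
    {η α₁ : ℝ} (hη : 0 ≤ η) (hα₁ : 0 ≤ α₁)
    (hsmall : Real.exp (4 * (800 * (((d + 1 : ℕ) : ℝ) + 1) ^ 2 * (((d + 1 : ℕ) : ℝ) + 4)) * α₀')
      * (1 + 8 * (131072 * (((d + 1 : ℕ) : ℝ) + 1) ^ 2) * α₁) ≤ 2)
    (hc₃ : 2 * α₁ ≤ c3 (d + 1) (ℓ + 1)) (hsm : 4096 * ((d + 1 : ℕ) : ℝ) * α₁ ≤ 1)
    (a : AfldY (Matrix (Fin N) (Fin N) ℂ) i) (s : BlkCubeY i c)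
    (ha : ∀ (ν : Fin (d + 1)) (v : Site (PV d ℓ i.m i.K hd hL) 0), blkOf (cubeFamY i c).toDomains (toBox i.hN v) = s →
      η * ‖a ν v‖ ≤ α₁ * ((((ℓ + 1) ^ s.1.1 : ℕ) : ℝ))⁻¹)
    (w : SiteY i) (hw : blkCubeY i c w = s) :
    ‖kFCubeY i c (parKnitCubeY i c) (fun _ _ => 1) (mulY i (fluct η a) (fun _ _ => 1)) s w‖ ≤ CqK d * α₁ * (W (cubeFamY i c).toDomains s)⁻¹ := by
  letI : CStarAlgebra (Matrix (Fin N) (Fin N) ℂ) := {}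
  set u := parKnitCubeY i c (mulY i (fluct η a) (fun _ _ => 1)) (blkCornerCubeY i c s) w with hu
  set ε : ℝ := 154 * ((d : ℝ) + 1) * α₁ with hε
  have hε0 : 0 ≤ ε := by positivity
  have hd1 : ((d + 1 : ℕ) : ℝ) = (d : ℝ) + 1 := by push_cast; ring
  have hε2 : ε ≤ 1 / 4 := by rw [hd1] at hsm; rw [hε]; nlinarith
  have h1 : ‖(u : Matrix (Fin N) (Fin N) ℂ) - 1‖ ≤ ε := norm_parKnitCubeY_mulY_one_sub_one_le i c hα' hα3 hα4 hη hα₁ hsmall hc₃ hsm a s ha hw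
  have h2 : ‖((u⁻¹ : (Matrix (Fin N) (Fin N) ℂ)ˣ) : Matrix (Fin N) (Fin N) ℂ) - 1‖ ≤ 2 * ε := norm_inv_sub_one_le u (by linarith) h1
  have hW := W_pos (cubeFamY i c).toDomains s
  refine ContinuousLinearMap.opNorm_le_bound _ (by unfold CqK; positivity) fun X => ?_
  have e : kFCubeY i c (parKnitCubeY i c) (fun _ _ => 1) (mulY i (fluct η a) (fun _ _ => 1)) s w X =
      (W (cubeFamY i c).toDomains s)⁻¹ • (R u X - X) := by
    simp only [kFCubeY, FunLike.coe_sub, Pi.sub_apply, B9Eq360DeltaPrimeACubeY.kQCubeY_apply, parKnitCubeY_one, R_one]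
    rw [← smul_sub]
  rw [e, norm_smul, Real.norm_eq_abs, abs_of_pos (inv_pos.2 hW)]
  have hR := norm_R_sub_self_le_of_small u hε0 hε2 (h1.trans (by linarith)) h2 X
  calc (W (cubeFamY i c).toDomains s)⁻¹ * ‖R u X - X‖ ≤ (W (cubeFamY i c).toDomains s)⁻¹ * (5 * ε * ‖X‖) :=
        mul_le_mul_of_nonneg_left hR (inv_nonneg.2 hW.le)
    _ = CqK d * α₁ * (W (cubeFamY i c).toDomains s)⁻¹ * ‖X‖ := by rw [hε]; unfold CqK; ring

/-- ★★★ **(3.59) FOR THE CUBE's STARRED LETTER AT `parKnitCubeY`, BASE `U = 1`, R1's `hsF` SHAPE**: `‖sF(z)‖ ≤ C_q^K·α₁` under the own-level (3.37) on the block of `z`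
(`sF = sQ(e^{iηa}·1) − sQ(1)`; the leg back to the corner is the inverse, `parKnitCubeY_inv`). [cite: Balaban1985BackgroundPropagators, (3.59) p.402, (3.24) p.394, (3.37) p.396, Cor. 3.5 p.407, p.409 l.3–5] -/
theorem norm_sFCubeY_parKnitCubeY_one_le
    {α₀' : ℝ} (hα' : 0 < α₀') (hα3 : C0 (d + 1) * α₀' ≤ 1 / 3) (hα4 : 4 * α₀' ≤ c2' (d + 1) (ℓ + 1))
    {η α₁ : ℝ} (hη : 0 ≤ η) (hα₁ : 0 ≤ α₁)
    (hsmall : Real.exp (4 * (800 * (((d + 1 : ℕ) : ℝ) + 1) ^ 2 * (((d + 1 : ℕ) : ℝ) + 4)) * α₀')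
      * (1 + 8 * (131072 * (((d + 1 : ℕ) : ℝ) + 1) ^ 2) * α₁) ≤ 2)
    (hc₃ : 2 * α₁ ≤ c3 (d + 1) (ℓ + 1)) (hsm : 4096 * ((d + 1 : ℕ) : ℝ) * α₁ ≤ 1)
    (a : AfldY (Matrix (Fin N) (Fin N) ℂ) i) (z : SiteY i)
    (ha : ∀ (ν : Fin (d + 1)) (v : Site (PV d ℓ i.m i.K hd hL) 0), blkOf (cubeFamY i c).toDomains (toBox i.hN v) = blkCubeY i c z →
      η * ‖a ν v‖ ≤ α₁ * ((((ℓ + 1) ^ (blkCubeY i c z).1.1 : ℕ) : ℝ))⁻¹) :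
    ‖sFCubeY i c (parKnitCubeY i c) (fun _ _ => 1) (mulY i (fluct η a) (fun _ _ => 1)) z‖ ≤ CqK d * α₁ := by
  letI : CStarAlgebra (Matrix (Fin N) (Fin N) ℂ) := {}
  set u := parKnitCubeY i c (mulY i (fluct η a) (fun _ _ => 1)) (blkCornerCubeY i c (blkCubeY i c z)) z with hu
  set ε : ℝ := 154 * ((d : ℝ) + 1) * α₁ with hε
  have hε0 : 0 ≤ ε := by positivity
  have hd1 : ((d + 1 : ℕ) : ℝ) = (d : ℝ) + 1 := by push_cast; ring
  have hε2 : ε ≤ 1 / 4 := by rw [hd1] at hsm; rw [hε]; nlinarith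
  have h1 : ‖(u : Matrix (Fin N) (Fin N) ℂ) - 1‖ ≤ ε := norm_parKnitCubeY_mulY_one_sub_one_le i c hα' hα3 hα4 hη hα₁ hsmall hc₃ hsm a _ ha rfl
  have h2 : ‖((u⁻¹ : (Matrix (Fin N) (Fin N) ℂ)ˣ) : Matrix (Fin N) (Fin N) ℂ) - 1‖ ≤ 2 * ε := norm_inv_sub_one_le u (by linarith) h1
  refine ContinuousLinearMap.opNorm_le_bound _ (by unfold CqK; positivity) fun X => ?_
  have e : sFCubeY i c (parKnitCubeY i c) (fun _ _ => 1) (mulY i (fluct η a) (fun _ _ => 1)) z X = R u⁻¹ X - X := by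
    simp only [sFCubeY, FunLike.coe_sub, Pi.sub_apply, B9Eq360DeltaPrimeACubeY.sQCubeY_apply, parKnitCubeY_one, R_one]
    rw [parKnitCubeY_inv]
  rw [e]
  have hR := norm_R_sub_self_le_of_small u⁻¹ hε0 hε2 h2 (by rw [inv_inv]; exact h1.trans (by linarith)) X
  calc ‖R u⁻¹ X - X‖ ≤ 5 * ε * ‖X‖ := hR
    _ = CqK d * α₁ * ‖X‖ := by rw [hε]; unfold CqK; ring

end Main

end Literature.MathematicalPhysics.QuantumFieldTheory.Balaban1983to89.B9Eq359CubeKernelsKnitAtOne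

end
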